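import Summits.CriticalPhenomena.CardyFormulaZ2.Theorems.CardySusyWardParafermionFamiliesToSLESixFluxPropagationGreen
import Literature.Probability.LatticeModels.MeshDomainJordan

/-!
# Flux propagation (stub S6 of line `strip-anchored-vertex-normalisation`, crux stmt-CriticalPhenomena-10814), IV: the theorem

`stub_fluxPropagationI` (registered signature, χ = i): given the uniform inner envelope, along any family `Λ`
of any Dobrushin domain `D` on which the staggered combination AND the vertex observable vanish at scale
`δ^{1/3}` on compacts, the wall flux of the half-CR corner form through every straight piece of wall is
`o(δ^{-2/3})`. This file counts the vertices carrying the per-vertex majorant `phi` of helper file III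
(`98` per depth layer on the transversals, `O(r²/(hδ))` regular staircase vertices, `O(r²/h²)` staircase
corners), sums (`Σ_j j^{-1/3}`, helper file II), and assembles the contour argument along the filter
`𝓝[>] 0` (admissibility and `meshDomain` of the collar eventually, `VertexVanishes`/`StaggeredVanishes` on the
collar, `h` chosen from `η` first, then `ε`). [folklore]
-/

noncomputable section

namespace Summit.CriticalPhenomena.CardyFormulaZ2.Theorems.ParafermionFamiliesToSLESix.StripAnchored

open MeasureTheory Filter Set Metric Complex
open scoped Topology BigOperators ComplexConjugate
open Literature.Probability.LatticeModels
open Literature.Probability.RandomPlanarGeometry (DobrushinDomain)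
open Literature.Barriers.CriticalPhenomena (medialCornersAt medialVertexOf)
open Literature.Barriers.CriticalPhenomena.HalfCRGreen (coeff twin)
open Summit.CriticalPhenomena.CardyFormulaZ2.Cruxes.EdgePrecompact.QkzStripBoundaryArm (cornerObs UniformInnerEnvelope)
open Summit.CriticalPhenomena.CardyFormulaZ2.Theorems.ParafermionPrecompact.Negative (IsFamily VanishesOn)

namespace S6

section Estimates

variable {D : DobrushinDomain} {E : DiscreteDobrushin} {w₀ n : ℂ} {r h δ C ε : ℝ} {N : ℕ}
  (hw : LocalHalfPlane D w₀ n r) (hEΩ : E.Ω = D.carrier) (hEδ : E.δ = δ) (hE : E.IsZdAdmissible)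
  (hh : 0 < h) (hhr : h ≤ r / 4) (hδh : δ ≤ h / 16) (hC : 1 ≤ C) (hε : 0 ≤ ε)
  (hN1 : h / (8 * δ) ≤ N) (hN2 : (N : ℝ) ≤ h / (8 * δ) + 1)
  (hmesh : ∀ x : Site 2, meshPoint δ x ∈ collar w₀ n (2 * r) (h / 4) (3 * h) → x ∈ meshDomain D.carrier δ)
  (hUIE : ∀ (v f : Site 2), IsCorner v f → ∀ R : ℕ, 1 ≤ R →
    (R : ℝ) * δ ≤ infDist (meshPoint δ v) D.carrierᶜ → ‖cornerObs E δ v f‖ ≤ C * (R : ℝ) ^ (-(1:ℝ) / 3))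
  (hVan : ∀ p : Site 2 × Fin 2, medialPoint δ (medialVertexOf p) ∈ collar w₀ n (2 * r) (h / 4) (3 * h) →
    ‖vertexObs E δ (medialVertexOf p)‖ ≤ ε * δ ^ ((1:ℝ) / 3))
  (hSt : ∀ p : Site 2 × Fin 2, medialPoint δ (medialVertexOf p) ∈ collar w₀ n (2 * r) (h / 4) (3 * h) →
    ‖stagger E δ p‖ ≤ ε * δ ^ ((1:ℝ) / 3))

include hw hEδ hE in
/-- **Transversal layers are thin**: at most `98` vertices of the lateral strips per depth layer (two boxes of doubled coordinates of side `7`). [folklore] -/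
theorem card_layer_le (j : ℕ) :
    ((((Sset E w₀ n δ r h N).filter (fun p => r - δ ≤ |σc w₀ n δ p|)).filter (fun p => jp w₀ n δ p = j)).card : ℝ) ≤ 98 := by
  have hn := hw.1
  have hδ : 0 < δ := hEδ ▸ hE.delta_pos
  -- the two box centres, at wall coordinates `((j+1)δ, ±(r - δ/2))`
  set c : Bool → ℂ := fun b => w₀ + n * (((((j : ℝ) + 1) * δ : ℝ) : ℂ) + (((if b then 1 else -1) * (r - δ / 2) : ℝ) : ℂ) * I)
  have hT := card_le_of_UV_mem
    (P := ((Sset E w₀ n δ r h N).filter (fun p => r - δ ≤ |σc w₀ n δ p|)).filter (fun p => jp w₀ n δ p = j))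
    (T := uvBox δ (c true) (3 / 2) ∪ uvBox δ (c false) (3 / 2)) ?_
  · have h1 := card_uvBox_le δ (c true) (d := 3 / 2) (by norm_num)
    have h2 := card_uvBox_le δ (c false) (d := 3 / 2) (by norm_num)
    have h4 : ((((Sset E w₀ n δ r h N).filter (fun p => r - δ ≤ |σc w₀ n δ p|)).filter (fun p => jp w₀ n δ p = j)).card : ℝ) ≤
        ((uvBox δ (c true) (3 / 2)).card : ℝ) + ((uvBox δ (c false) (3 / 2)).card : ℝ) := by
      exact_mod_cast hT.trans (Finset.card_union_le _ _)
    nlinarith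
  · intro p hp
    rw [Finset.mem_filter, Finset.mem_filter] at hp
    obtain ⟨⟨hpS, hl⟩, hj⟩ := hp
    have hpt : 0 < τc w₀ n δ p := ((mem_Sset hE).1 hpS).2.2.1
    have hps : |σc w₀ n δ p| < r := ((mem_Sset hE).1 hpS).2.1
    -- the layer: `|t - (j+1)δ| ≤ δ`
    have hτj : |τc w₀ n δ p - ((j : ℝ) + 1) * δ| ≤ δ := by
      simp only [jp] at hj
      have hup : τc w₀ n δ p / δ - 1 / 2 < (j : ℝ) + 1 := hj ▸ Nat.lt_floor_add_one _
      have hup' : τc w₀ n δ p < ((j : ℝ) + 3 / 2) * δ := by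
        rw [← div_lt_iff₀ hδ]; linarith
      refine abs_le.2 ⟨?_, by linarith⟩
      rcases Nat.eq_zero_or_pos j with h0 | hpos
      · subst h0; push_cast; linarith
      · have h1 : (1:ℝ) ≤ τc w₀ n δ p / δ - 1 / 2 := Nat.floor_pos.1 (hj ▸ hpos)
        have h2 := mul_le_mul_of_nonneg_right (hj ▸ Nat.floor_le (by linarith) : (j : ℝ) ≤ τc w₀ n δ p / δ - 1 / 2) hδ.le
        rw [sub_mul, div_mul_cancel₀ _ hδ.ne'] at h2; linarith
    -- the strip: `|s ∓ (r - δ/2)| ≤ δ/2`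
    have key : ∀ b : Bool, |σc w₀ n δ p - (if b then 1 else -1) * (r - δ / 2)| ≤ δ / 2 → (U p, V p) ∈ uvBox δ (c b) (3 / 2) := by
      intro b hb
      refine UV_mem_uvBox hδ ((norm_sub_le_coords hn w₀ _ _).trans ?_)
      rw [(nco_tco_param hn w₀ _ _).1, (nco_tco_param hn w₀ _ _).2]
      change |τc w₀ n δ p - _| + |σc w₀ n δ p - _| ≤ _
      linarith
    rw [Finset.mem_union]
    by_cases hsg : 0 ≤ σc w₀ n δ p
    · refine Or.inl (key true ?_)
      rw [abs_of_nonneg hsg] at hl hps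
      simp only [ite_true, one_mul]
      exact abs_le.2 ⟨by linarith, by linarith⟩
    · refine Or.inr (key false ?_)
      rw [abs_of_neg (not_le.1 hsg)] at hl hps
      simp only [Bool.false_eq_true, ite_false, neg_mul, one_mul, sub_neg_eq_add]
      exact abs_le.2 ⟨by linarith, by linarith⟩

include hw hEδ hE hh hhr hδh hC hN1 hN2 in
/-- **(Σ₁) The two transversals cost `≤ 392·C·(1 + (3/2)(2h/δ)^{2/3})`**: `98` vertices per layer, envelope `C·max(1,j)^{-1/3}` per corner, harmonic sum. [folklore] -/
theorem sum_lat_le : (∑ p ∈ Sset E w₀ n δ r h N, if r - δ ≤ |σc w₀ n δ p| then 4 * C * gj (jp w₀ n δ p) else 0) ≤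
    392 * C * (1 + 3 / 2 * (2 * h / δ) ^ ((2:ℝ) / 3)) := by
  obtain ⟨hδ, -, -, -, -⟩ := basics hEδ hE hh hhr hδh hN1 hN2
  have hC0 : 0 ≤ C := by linarith
  set S := Sset E w₀ n δ r h N with hSdef
  set J : ℕ := ⌊2 * h / δ⌋₊ with hJ
  have hjpJ : ∀ p ∈ S, jp w₀ n δ p ∈ Finset.range (J + 1) := fun p hp => by
    rw [Finset.mem_range, Nat.lt_succ_iff]
    refine Nat.floor_le_floor ?_
    linarith [div_le_div_of_nonneg_right (lt_of_mem hw hEδ hE hh hhr hδh hN1 hN2 hp).1.le hδ.le]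
  rw [← Finset.sum_filter, ← Finset.mul_sum]
  have h2 : ∑ p ∈ S.filter (fun p => r - δ ≤ |σc w₀ n δ p|), gj (jp w₀ n δ p) ≤ 98 * (1 + 3 / 2 * (J : ℝ) ^ ((2:ℝ) / 3)) := by
    rw [← Finset.sum_fiberwise_of_maps_to (g := jp w₀ n δ) (t := Finset.range (J + 1))
      (fun p hp => hjpJ p (Finset.mem_filter.1 hp).1)]
    have h3 : ∀ j ∈ Finset.range (J + 1),
        ∑ p ∈ (S.filter (fun p => r - δ ≤ |σc w₀ n δ p|)).filter (fun p => jp w₀ n δ p = j), gj (jp w₀ n δ p) ≤ 98 * gj j := by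
      intro j _
      rw [Finset.sum_congr rfl fun p hp => by rw [(Finset.mem_filter.1 hp).2], Finset.sum_const, nsmul_eq_mul]
      exact mul_le_mul_of_nonneg_right (card_layer_le hw hEδ hE j) (gj_nonneg j)
    refine (Finset.sum_le_sum h3).trans ?_
    rw [← Finset.mul_sum]
    exact mul_le_mul_of_nonneg_left (sum_layers_le J) (by norm_num)
  have h5 : (J : ℝ) ^ ((2:ℝ) / 3) ≤ (2 * h / δ) ^ ((2:ℝ) / 3) :=
    Real.rpow_le_rpow (Nat.cast_nonneg J) (Nat.floor_le (by positivity)) (by norm_num)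
  nlinarith [mul_le_mul_of_nonneg_left h5 (by positivity : (0:ℝ) ≤ 4 * C * 98 * (3 / 2))]

include hw hEδ hE hh hhr hδh hN1 hN2 in
/-- **The staircase vertices are few.** With `Θ = 64r/h + 4` (grid lines meeting the region): at most `2Θ(8r/δ + 1)` vertices of `S′` are adjacent to a grid line, at most `Θ²` to two. [folklore] -/
theorem card_stair_le :
    (((Sset E w₀ n δ r h N).filter (fun p => 1 ≤ ncross N p)).card : ℝ) ≤ 2 * (64 * r / h + 4) * (8 * r / δ + 1) ∧
    (((Sset E w₀ n δ r h N).filter (fun p => ncross N p = 2)).card : ℝ) ≤ (64 * r / h + 4) ^ 2 := by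
  obtain ⟨hδ, -, hN2', hLlo, -⟩ := basics hEδ hE hh hhr hδh hN1 hN2
  have hr := hw.2.1
  have hm2 : (2:ℤ) ≤ 2 * N := by omega
  set S := Sset E w₀ n δ r h N with hSdef
  set wd : ℝ := 2 * (2 * r / δ) with hwd
  set I' : ℝ → Finset ℤ := fun α => Finset.Icc ⌈α - wd⌉ ⌊α + wd⌋ with hI'
  set G' : ℝ → Finset ℤ := fun α => gridLines (2 * N) ⌈α - wd⌉ ⌊α + wd⌋ with hG'
  have hwd1 : (1:ℝ) ≤ wd := by
    rw [hwd]; have : (1:ℝ) ≤ 2 * r / δ := by rw [le_div_iff₀ hδ]; linarith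
    linarith
  -- every vertex of `S` has its doubled coordinates in the box around `w₀`
  have hUV : ∀ p ∈ S, U p ∈ I' (2 * w₀.re / δ) ∧ V p ∈ I' (2 * w₀.im / δ) := fun p hp => by
    have := UV_mem_uvBox hδ (p := p) (c := w₀) (d := 2 * r / δ)
      (by rw [div_mul_cancel₀ _ hδ.ne']; linarith [(lt_of_mem hw hEδ hE hh hhr hδh hN1 hN2 hp).2])
    simpa only [uvBox, Finset.mem_product] using this
  have hcardI : ∀ α : ℝ, ((I' α).card : ℝ) ≤ 8 * r / δ + 1 := fun α => by
    have h1 := card_Icc_ceil_floor_le α wd (by linarith)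
    rw [show 2 * wd + 1 = 8 * r / δ + 1 by rw [hwd]; ring] at h1; exact h1
  have hcardG : ∀ α : ℝ, ((G' α).card : ℝ) ≤ 64 * r / h + 4 := fun α => by
    have hIle : ⌈α - wd⌉ ≤ ⌊α + wd⌋ := by
      rw [Int.ceil_le]; linarith [Int.lt_floor_add_one (α + wd)]
    refine (card_gridLines_le (by omega : (0:ℤ) < 2 * N) hIle).trans ?_
    have hmr : ((2 * N : ℤ) : ℝ) = 2 * N := by push_cast; ring
    have h1 : ((⌊α + wd⌋ : ℤ) : ℝ) - ((⌈α - wd⌉ : ℤ) : ℝ) ≤ 2 * wd := by linarith [Int.floor_le (α + wd), Int.le_ceil (α - wd)]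
    have h2 : (((⌊α + wd⌋ : ℤ) : ℝ) - ((⌈α - wd⌉ : ℤ) : ℝ)) / ((2 * N : ℤ) : ℝ) ≤ 2 * wd / ((2 * N : ℤ) : ℝ) :=
      div_le_div_of_nonneg_right h1 (by rw [hmr]; positivity)
    have h3 : 2 * wd / ((2 * N : ℤ) : ℝ) ≤ 32 * r / h := by
      rw [hmr, hwd, div_le_div_iff₀ (by positivity) hh, show 2 * (2 * (2 * r / δ)) * h = 8 * r * (h / δ) by ring]
      have h4 : h / δ ≤ 8 * N := by rw [div_le_iff₀ hδ]; linarith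
      nlinarith
    rw [show 64 * r / h = 2 * (32 * r / h) by ring]
    linarith [h2.trans h3]
  -- membership
  have hmemG : ∀ p ∈ S, ((U p % (2 * N) = 0 ∨ U p % (2 * N) = 2 * N - 1) → U p ∈ G' (2 * w₀.re / δ)) ∧
      ((V p % (2 * N) = 0 ∨ V p % (2 * N) = 2 * N - 1) → V p ∈ G' (2 * w₀.im / δ)) := fun p hp =>
    ⟨fun hc => mem_gridLines hm2 hc (Finset.mem_Icc.1 (hUV p hp).1).1 (Finset.mem_Icc.1 (hUV p hp).1).2,
      fun hc => mem_gridLines hm2 hc (Finset.mem_Icc.1 (hUV p hp).2).1 (Finset.mem_Icc.1 (hUV p hp).2).2⟩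
  have hG1 := hcardG (2 * w₀.re / δ); have hG2 := hcardG (2 * w₀.im / δ)
  have hI1 := hcardI (2 * w₀.re / δ); have hI2 := hcardI (2 * w₀.im / δ)
  have hnn := fun (s : Finset ℤ) => Nat.cast_nonneg (α := ℝ) s.card
  constructor
  · have hT := card_le_of_UV_mem (P := S.filter (fun p => 1 ≤ ncross N p))
      (T := (G' (2 * w₀.re / δ) ×ˢ I' (2 * w₀.im / δ)) ∪ (I' (2 * w₀.re / δ) ×ˢ G' (2 * w₀.im / δ))) fun p hp => by
      rw [Finset.mem_filter] at hp
      rw [Finset.mem_union, Finset.mem_product, Finset.mem_product]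
      rcases (ncross_cases N p).2.2 hp.2 with hc | hc
      exacts [Or.inl ⟨(hmemG p hp.1).1 hc, (hUV p hp.1).2⟩, Or.inr ⟨(hUV p hp.1).1, (hmemG p hp.1).2 hc⟩]
    have h1 := (hT.trans (Finset.card_union_le _ _))
    rw [Finset.card_product, Finset.card_product] at h1
    have h2 : ((S.filter (fun p => 1 ≤ ncross N p)).card : ℝ) ≤
        ((G' (2 * w₀.re / δ)).card : ℝ) * (I' (2 * w₀.im / δ)).card + ((I' (2 * w₀.re / δ)).card : ℝ) * (G' (2 * w₀.im / δ)).card := by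
      exact_mod_cast h1
    nlinarith [hnn (G' (2 * w₀.re / δ)), hnn (G' (2 * w₀.im / δ)), hnn (I' (2 * w₀.re / δ)), hnn (I' (2 * w₀.im / δ))]
  · have hT := card_le_of_UV_mem (P := S.filter (fun p => ncross N p = 2))
      (T := G' (2 * w₀.re / δ) ×ˢ G' (2 * w₀.im / δ)) fun p hp => by
      rw [Finset.mem_filter] at hp
      obtain ⟨hcU, hcV⟩ := (ncross_cases N p).1.2 hp.2
      exact Finset.mem_product.2 ⟨(hmemG p hp.1).1 hcU, (hmemG p hp.1).2 hcV⟩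
    rw [Finset.card_product] at hT
    have h2 : ((S.filter (fun p => ncross N p = 2)).card : ℝ) ≤ ((G' (2 * w₀.re / δ)).card : ℝ) * (G' (2 * w₀.im / δ)).card := by
      exact_mod_cast hT
    nlinarith [hnn (G' (2 * w₀.re / δ)), hnn (G' (2 * w₀.im / δ))]

include hw hEΩ hEδ hE hh hhr hδh hC hε hN1 hN2 hmesh hUIE hVan hSt in
/-- **The estimate of the open flux at one scale**: `Σ_{S′} φ`. [folklore] -/
theorem norm_open_le : ‖∑ p ∈ Sset E w₀ n δ r h N, bflux E δ (Sset E w₀ n δ r h N) p‖ ≤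
    392 * C * (1 + 3 / 2 * (2 * h / δ) ^ ((2:ℝ) / 3)) +
      3 * ε * δ ^ ((1:ℝ) / 3) * (2 * (64 * r / h + 4) * (8 * r / δ + 1)) + 4 * C * (64 * r / h + 4) ^ 2 := by
  obtain ⟨hδ, -, -, -, -⟩ := basics hEδ hE hh hhr hδh hN1 hN2
  refine ((norm_sum_le _ _).trans (Finset.sum_le_sum fun p hp =>
    norm_bflux_le_phi hw hEΩ hEδ hE hh hhr hδh hC hε hN1 hN2 hmesh hUIE hVan hSt hp)).trans ?_
  unfold phi
  rw [Finset.sum_add_distrib, Finset.sum_add_distrib]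
  obtain ⟨c1, c2⟩ := card_stair_le hw hEδ hE hh hhr hδh hN1 hN2
  refine add_le_add (add_le_add (sum_lat_le hw hEδ hE hh hhr hδh hC hN1 hN2) ?_) ?_ <;>
    rw [← Finset.sum_filter, Finset.sum_const, nsmul_eq_mul, mul_comm]
  · have hsub : ((Sset E w₀ n δ r h N).filter (fun p => (|σc w₀ n δ p| < r - δ ∧ h < τc w₀ n δ p) ∧ 1 ≤ ncross N p)).card ≤
        ((Sset E w₀ n δ r h N).filter (fun p => 1 ≤ ncross N p)).card :=
      Finset.card_le_card fun p hp => by simp only [Finset.mem_filter] at hp ⊢; exact ⟨hp.1, hp.2.2⟩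
    exact mul_le_mul_of_nonneg_left ((Nat.cast_le.2 hsub).trans c1) (by positivity)
  · have hsub : ((Sset E w₀ n δ r h N).filter (fun p => (|σc w₀ n δ p| < r - δ ∧ h < τc w₀ n δ p) ∧ ncross N p = 2)).card ≤
        ((Sset E w₀ n δ r h N).filter (fun p => ncross N p = 2)).card :=
      Finset.card_le_card fun p hp => by simp only [Finset.mem_filter] at hp ⊢; exact ⟨hp.1, hp.2.2⟩
    exact mul_le_mul_of_nonneg_left ((Nat.cast_le.2 hsub).trans c2) (by linarith)

end Estimates

end S6

open S6 in
/-- **(S6) FLUX PROPAGATION at `χ = i` — the contour argument** (registered stub `stub_fluxPropagationI` of the line `strip-anchored-vertex-normalisation`, crux stmt-CriticalPhenomena-10814). Given the uniform inner envelope (S3), along any family `Λ` of any Dobrushin domain `D` (six family fields) on which the staggered combination AND the vertex observable vanish at scale `δ^{1/3}` on compacts, the wall flux of the half-CR corner form through every straight piece of wall is `o(δ^{-2/3})`: for every `η > 0` there is a box height `h ∈ (0, r)` with `‖wallFlux i (Λ δ) δ (wallBox w₀ n r h)‖ ≤ η δ^{-2/3}` eventually in `δ`. Proof: `S6.wallFlux_eq_neg_open`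 (Green's identity on `S′` + S2: wall flux = −open flux) and `S6.norm_open_le` (transversals `392C(1 + (3/2)(2h/δ)^{2/3})` by the envelope, regular staircase vertices `3εδ^{1/3}·O(r²/(hδ))` by the exact side-pair decomposition with S1 and the two vanishing hypotheses, staircase corners `4C·O(r²/h²)`); `h` is chosen with `(2h)^{2/3} ≤ η/(2352 C)`, then `ε = η/(12·N_top)`, then `δ` small. [folklore] -/
theorem stub_fluxPropagationI : UniformInnerEnvelope → ∀ (D : DobrushinDomain) (Λ : ℝ → DiscreteDobrushin), IsFamily D Λ → StaggeredVanishes D Λ → VertexVanishes D Λ → ∀ (w₀ n : ℂ) (r : ℝ), LocalHalfPlane D w₀ n r → ∀ η > (0:ℝ), ∃ h : ℝ, 0 < h ∧ h < r ∧ ∀ᶠ δ in 𝓝[>] (0:ℝ), ‖wallFlux Complex.I (Λ δ) δ (wallBox w₀ n r h)‖ ≤ η * δ ^ (-(2:ℝ) / 3) := by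
  intro hUIE D Λ hΛ hStag hV w₀ n r hwall η hη
  obtain ⟨C₀, hC₀⟩ := hUIE
  obtain ⟨C, hCdef⟩ : ∃ C : ℝ, C = max C₀ 1 := ⟨_, rfl⟩
  have hC : 1 ≤ C := hCdef ▸ le_max_right _ _
  have hCC₀ : C₀ ≤ C := hCdef ▸ le_max_left _ _
  have hr : 0 < r := hwall.2.1
  have hpow : ∀ a : ℝ, Filter.Tendsto (fun x : ℝ => (a * x) ^ ((2:ℝ) / 3)) (𝓝[>] (0:ℝ)) (𝓝 0) := fun a => by
    have hc : Continuous (fun x : ℝ => (a * x) ^ ((2:ℝ) / 3)) := (continuous_const.mul continuous_id).rpow_const fun x => Or.inr (by norm_num)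
    simpa [Real.zero_rpow (by norm_num : ((2:ℝ) / 3) ≠ 0)] using tendsto_nhdsWithin_of_tendsto_nhds (hc.tendsto 0)
  -- choice of the box height `h`
  obtain ⟨h, hh1, hh0, hh2⟩ := (((hpow 2).eventually_le_const (by positivity : (0:ℝ) < η / (2352 * C))).and
    (Ioo_mem_nhdsGT (by positivity : (0:ℝ) < r / 4))).exists
  refine ⟨h, hh0, by linarith, ?_⟩
  -- constants of the estimate and the common smallness `ε`
  obtain ⟨Θ, hΘ⟩ : ∃ Θ : ℝ, Θ = 64 * r / h + 4 := ⟨_, rfl⟩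
  have hΘ0 : 0 < Θ := by rw [hΘ]; positivity
  obtain ⟨ε, hεdef⟩ : ∃ ε : ℝ, ε = η / (12 * (2 * Θ * (8 * r + 1))) := ⟨_, rfl⟩
  have hε : 0 < ε := by rw [hεdef]; positivity
  -- the collar and the eventualities
  have hK : IsCompact (collar w₀ n (2 * r) (h / 4) (3 * h)) := isCompact_collar hwall.1 w₀ _ _ _
  have hKD : collar w₀ n (2 * r) (h / 4) (3 * h) ⊆ D.carrier := collar_subset hwall (by positivity) (by linarith)
  have e5 : ∀ᶠ δ in 𝓝[>] (0:ℝ), δ ∈ Set.Ioo (0:ℝ) (min (h / 16) 1) := Ioo_mem_nhdsGT (by positivity)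
  have e6 : ∀ᶠ δ in 𝓝[>] (0:ℝ), (1 * δ) ^ ((2:ℝ) / 3) ≤ η / (4 * (392 * C + 4 * C * Θ ^ 2)) :=
    (hpow 1).eventually_le_const (by positivity)
  filter_upwards [hΛ.2.2.2.2.2, D.toJordanDomain.eventually_forall_mem_meshDomain' hK hKD, hV _ hK hKD ε hε,
    hStag _ hK hKD ε hε, e5, e6] with δ hE hmesh hVan hSt hδI hδQ
  obtain ⟨hδ, hδlt⟩ := hδI
  have hδh : δ ≤ h / 16 := hδlt.le.trans (min_le_left _ _)
  have hδ1 : δ ≤ 1 := hδlt.le.trans (min_le_right _ _)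
  have hEΩ : (Λ δ).Ω = D.carrier := hΛ.1 δ
  have hEδ : (Λ δ).δ = δ := hΛ.2.1 δ
  have hN1 : h / (8 * δ) ≤ (⌈h / (8 * δ)⌉₊ : ℕ) := Nat.le_ceil _
  have hN2 : ((⌈h / (8 * δ)⌉₊ : ℕ) : ℝ) ≤ h / (8 * δ) + 1 := (Nat.ceil_lt_add_one (by positivity)).le
  have hUIE' : ∀ (v f : Site 2), IsCorner v f → ∀ R : ℕ, 1 ≤ R →
      (R : ℝ) * δ ≤ infDist (meshPoint δ v) D.carrierᶜ → ‖cornerObs (Λ δ) δ v f‖ ≤ C * (R : ℝ) ^ (-(1:ℝ) / 3) := by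
    intro v f hvf R hR hRd
    have h1 := hC₀ D (Λ δ) hEΩ hE v f hvf R hR (by rw [hEδ]; exact hRd)
    rw [hEδ] at h1
    exact h1.trans (mul_le_mul_of_nonneg_right hCC₀ (Real.rpow_nonneg (Nat.cast_nonneg R) _))
  have hopen := norm_open_le hwall hEΩ hEδ hE hh0 hh2.le hδh hC hε.le hN1 hN2 hmesh.1 hUIE'
    (fun p hp => hVan (medialVertexOf p) hp) (fun p hp => hSt p hp)
  rw [wallFlux_eq_neg_open hwall hEΩ hEδ hE hh0 hh2.le hδh hN1 hN2 hmesh.1, norm_neg]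
  refine hopen.trans ?_
  -- final arithmetic: multiply by `Q = δ^{2/3}`
  obtain ⟨Q, hQdef⟩ : ∃ Q : ℝ, Q = δ ^ ((2:ℝ) / 3) := ⟨_, rfl⟩
  have hQ : 0 < Q := by rw [hQdef]; exact Real.rpow_pos_of_pos hδ _
  rw [one_mul, ← hQdef] at hδQ
  have he3Q : δ ^ ((1:ℝ) / 3) = δ / Q := by
    rw [eq_div_iff hQ.ne', hQdef, ← Real.rpow_add hδ]; norm_num
  rw [show (-(2:ℝ) / 3) = -((2:ℝ) / 3) by ring, Real.rpow_neg hδ.le, ← hQdef, ← div_eq_mul_inv, le_div_iff₀ hQ,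
    Real.div_rpow (by positivity) hδ.le, ← hQdef, he3Q]
  rw [show (392 * C * (1 + 3 / 2 * ((2 * h) ^ ((2:ℝ) / 3) / Q)) + 3 * ε * (δ / Q) * (2 * (64 * r / h + 4) * (8 * r / δ + 1)) +
      4 * C * (64 * r / h + 4) ^ 2) * Q = (392 * C + 4 * C * Θ ^ 2) * Q + 588 * C * (2 * h) ^ ((2:ℝ) / 3) +
      6 * ε * Θ * (8 * r + δ) by rw [hΘ]; field_simp; ring]
  have t1 : (392 * C + 4 * C * Θ ^ 2) * Q ≤ η / 4 :=
    calc (392 * C + 4 * C * Θ ^ 2) * Q ≤ (392 * C + 4 * C * Θ ^ 2) * (η / (4 * (392 * C + 4 * C * Θ ^ 2))) := by gcongr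
      _ = η / 4 := by field_simp
  have t2 : 588 * C * (2 * h) ^ ((2:ℝ) / 3) ≤ η / 4 :=
    calc 588 * C * (2 * h) ^ ((2:ℝ) / 3) ≤ 588 * C * (η / (2352 * C)) := by gcongr
      _ = η / 4 := by field_simp; ring
  have t3 : 6 * ε * Θ * (8 * r + δ) ≤ η / 4 :=
    calc 6 * ε * Θ * (8 * r + δ) ≤ 6 * ε * Θ * (8 * r + 1) := by gcongr
      _ = η / 4 := by rw [hεdef]; field_simp; ring
  linarith

end Summit.CriticalPhenomena.CardyFormulaZ2.Theorems.ParafermionFamiliesToSLESix.StripAnchored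

end
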